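import Summits.CriticalPhenomena.CardyFormulaZ2.Theorems.CardyBoundaryCoulombGasRectilinearSufficesApprox

/-!
# Lattice Jordan polygons with lattice marks: grid-line and fine-lattice lemmas

Support file for `PolygonReduction` / `Assembly` (routes CardyGluingRDE / CardyPolygonWords of
`CardyFormulaZ2`, item stmt-CriticalPhenomena-4784): **every conformal rectangle `D` admits, for
every `ε, τ > 0`, a conformal rectangle `P` whose carrier is the interior of a finite union of
closed `d`-cells of a square lattice `dℤ²`, whose four marked points are points of `dℤ²`, whose
mark parameters are `τ`-close to those of `D` and whose boundary loop is uniformly `ε`-close to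
that of `D`** (`exists_latticePolygon_close`, sibling file `CardyGluingRDEPolygonReductionLatticePolygon.lean`).
This file holds the lattice lemmas of that construction: the closed lattice polygon through a
cycle of adjacent sites of `ℤ²` at mesh `h` lies on the grid lines of mesh `h`
(`range_polygonLoop_subset_gridLines`), grid lines refine (`gridLines_mono`), and the closed
polygon through mesh points visits the fine lattice `(h/N)ℤ²` at all times in `(MN)⁻¹ℤ`
(`polygonLoop_mem_fineLattice`).
-/

noncomputable section

namespace Summit.CriticalPhenomena.CardyFormulaZ2.Theorems

namespace LatticePolygonApproximation

open Set Metric Complex Filter Topology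
open Literature.Probability.LatticeModels Literature.Probability.RandomPlanarGeometry
open Literature.Probability.Percolation (dist_meshPoint_of_adj)

/-- A point of a closed lattice edge of mesh `h` (between the mesh points of two adjacent sites of
`ℤ²`) lies on a grid line of mesh `h`. [folklore] -/
theorem mem_gridLines_of_mem_segment_meshPoint {h : ℝ} {x y : Site 2} (hxy : (zdGraph 2).Adj x y)
    {z : ℂ} (hz : z ∈ segment ℝ (meshPoint h x) (meshPoint h y)) :
    (∃ k : ℤ, z.re = h * k) ∨ ∃ k : ℤ, z.im = h * k := by
  -- reduce to `y = x + eᵢ`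
  wlog hxy' : ∃ i, y = x + Pi.single i 1 generalizing x y
  · obtain ⟨i, hi | hi⟩ := (zdGraph_adj_iff x y).1 hxy
    · exact this hxy hz ⟨i, hi⟩
    · exact this hxy.symm (by rwa [segment_symm]) ⟨i, hi⟩
  obtain ⟨i, rfl⟩ := hxy'
  rw [segment_eq_image_lineMap] at hz
  obtain ⟨t, -, rfl⟩ := hz
  rw [AffineMap.lineMap_apply_module']
  fin_cases i
  · -- horizontal edge: the imaginary part is constant
    refine Or.inr ⟨x 1, ?_⟩
    simp [meshPoint_im, Complex.add_im, Complex.sub_im]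
  · -- vertical edge: the real part is constant
    refine Or.inl ⟨x 0, ?_⟩
    simp [meshPoint_re, Complex.add_re, Complex.sub_re]

/-- The closed lattice polygon through a cycle of adjacent sites of `ℤ²` at mesh `h` lies on the
grid lines of mesh `h`. [folklore] -/
theorem range_polygonLoop_subset_gridLines {h : ℝ} {q : List (Site 2)} (hq : 0 < q.length)
    (hadj : ∀ (i : ℕ) (hi : i < q.length),
      (zdGraph 2).Adj q[i] (q[(i + 1) % q.length]'(Nat.mod_lt _ hq))) :
    range (polygonLoop (q.map (meshPoint h))) ⊆
      {z : ℂ | (∃ k : ℤ, z.re = h * k) ∨ ∃ k : ℤ, z.im = h * k} := by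
  have hne : q.map (meshPoint h) ≠ [] := List.ne_nil_of_length_pos (by rw [List.length_map]; exact hq)
  rw [range_polygonLoop hne]
  intro z hz
  obtain ⟨k, hk⟩ := mem_iUnion.1 hz
  have hkq : (k : ℕ) < q.length := k.2.trans_eq (List.length_map ..)
  have e1 : (q.map (meshPoint h))[(k : ℕ)] = meshPoint h (q[(k : ℕ)]) := List.getElem_map ..
  have e2 : (q.map (meshPoint h))[((k : ℕ) + 1) % (q.map (meshPoint h)).length]'(Nat.mod_lt _ k.pos) =
      meshPoint h (q[((k : ℕ) + 1) % q.length]'(Nat.mod_lt _ hq)) := by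
    simp [List.getElem_map]
  rw [e1, e2] at hk
  exact mem_gridLines_of_mem_segment_meshPoint (hadj k hkq) hk

/-- Grid lines of mesh `h` are grid lines of the finer mesh `h / N`. [folklore] -/
theorem gridLines_mono {h : ℝ} {N : ℕ} (hN : 0 < N) :
    {z : ℂ | (∃ k : ℤ, z.re = h * k) ∨ ∃ k : ℤ, z.im = h * k} ⊆
      {z : ℂ | (∃ k : ℤ, z.re = h / N * k) ∨ ∃ k : ℤ, z.im = h / N * k} := by
  have hN' : (N : ℝ) ≠ 0 := by exact_mod_cast hN.ne'
  rintro z (⟨k, hk⟩ | ⟨k, hk⟩)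
  · refine Or.inl ⟨N * k, ?_⟩
    rw [hk]; push_cast; field_simp
  · refine Or.inr ⟨N * k, ?_⟩
    rw [hk]; push_cast; field_simp

/-- **The times at which a closed lattice polygon visits the fine lattice.** Let `l` be the
list of mesh points (mesh `h`) of a list of `M ≥ 1` sites of `ℤ²` and let `σ ∈ (MN)⁻¹ℤ`. Then
`polygonLoop l σ` is a point of the lattice `(h/N)ℤ²` (an affine combination of two points of
`hℤ²` with coefficient in `N⁻¹ℤ`). [folklore] -/
theorem polygonLoop_mem_fineLattice {h : ℝ} {q : List (Site 2)} (hq : 0 < q.length)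
    {N : ℕ} (hN : 0 < N) {σ : ℝ} (hσ : ∃ C : ℤ, σ = C / (q.length * N)) :
    ∃ m n : ℤ, polygonLoop (q.map (meshPoint h)) σ = ((h / N : ℝ) : ℂ) * ((m : ℂ) + (n : ℂ) * Complex.I) := by
  set l := q.map (meshPoint h) with hl
  have hlen : l.length = q.length := by rw [hl, List.length_map]
  have hne : l ≠ [] := List.ne_nil_of_length_pos (by rw [hlen]; exact hq)
  obtain ⟨k, hk, θ, hθ, hkθ, hval⟩ := polygonLoop_eq_of_floor hne σ
  obtain ⟨C, hC⟩ := hσ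
  have hM : (0 : ℝ) < q.length := by exact_mod_cast hq
  have hNr : (0 : ℝ) < N := by exact_mod_cast hN
  -- `N θ` is an integer
  have hθint : ∃ K : ℤ, θ = K / N := by
    refine ⟨C - N * (q.length * ⌊σ⌋ + k), ?_⟩
    have e1 : (q.length : ℝ) * Int.fract σ = k + θ := by
      rw [← hkθ, hlen, mul_div_cancel₀ _ hM.ne']
    rw [Int.fract, mul_sub] at e1
    have e2 : (q.length : ℝ) * σ = C / N := by
      rw [hC, ← mul_div_assoc, mul_div_mul_left _ _ hM.ne']
    have hθ' : θ = C / N - q.length * ⌊σ⌋ - k := by linarith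
    push_cast
    rw [hθ', eq_div_iff hNr.ne']
    ring_nf
    field_simp
  obtain ⟨K, hK⟩ := hθint
  -- the edge from `q[k]` to `q[k+1]` is a unit lattice edge
  have hkq : k < q.length := by rw [← hlen]; exact hk
  set k' := (k + 1) % q.length with hk'
  have hk'q : k' < q.length := Nat.mod_lt _ hq
  refine ⟨N * q[k] 0 + K * (q[k'] 0 - q[k] 0), N * q[k] 1 + K * (q[k'] 1 - q[k] 1), ?_⟩
  rw [hval, AffineMap.lineMap_apply_module']
  have hgk : l[k] = meshPoint h q[k] := by simp [hl, List.getElem_map]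
  have hgk' : l[(k + 1) % l.length]'(Nat.mod_lt _ (by omega)) = meshPoint h q[k'] := by
    simp [hl, List.getElem_map, hk']
  rw [hgk, hgk', hK]
  apply Complex.ext
  · simp [meshPoint_re, meshPoint_im, Complex.add_re, Complex.sub_re, Complex.mul_re]
    field_simp
    ring
  · simp [meshPoint_re, meshPoint_im, Complex.add_im, Complex.sub_im, Complex.mul_im]
    field_simp
    ring

end LatticePolygonApproximation

end Summit.CriticalPhenomena.CardyFormulaZ2.Theorems
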